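import Mathlib
import Literature.Topology.FourManifolds.BalancedPresentation
import HarnessLib

/-!
# Peeling theorem for KMN encoding graphs, part 1/8: twinned definitions and free-group exponent sums

§1 repeats VERBATIM the skeleton-local definitions the target statement is built from — the `Piece` block
(`Cruxes/DoublesShadowLEOne/Lines/grade_one_ac.lean` §2, l.114–188; sha256 of the copied text `459bd727…`), the
`ShadowGraph` block (skeleton §3, l.192–280; `b52ead42…`) and `PeelCertificates` itself (skeleton §7, l.695–703;
`96feadb8…`) — inside this family's namespace, followed by `example : PeelCertificates ↔ <its body> := Iff.rfl`.
ANTI-SHADOWING: no other constant of the family has last name component `PeelCertificates`; the only theorem about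
it is `stub_peelCertificates` (closing module).  §2: optional inversion `sgnw`, exponent sums `expo`, the exponent
matrix `expoMat` of a square presentation, and `isUnit_det_expoMat`: if the normal closure of the relators is the
whole free group (`H₁ = 0`), the exponent matrix is unimodular over `ℤ`.

THE FAMILY (eight modules `Theorems/RootDecompAEDoublesShadowLEOnePeel*.lean` + the closing module
`Theorems/RootDecompAEDoublesShadowLEOneStubPeelCertificates.lean`, one namespace
`Summit.SmoothPoincare4.SmoothPoincare4.Theorems.RootDecompAEDoublesShadowLEOneStubPeelCertificates`, split by topic to respect the
400-line bound on proof files): `…PeelDefs` (verbatim twins of the skeleton's `Piece`, `ShadowGraph`,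
`PeelCertificates`; free-group exponent sums; `H₁ = 0 ⟹` unimodular exponent matrix) · `…PeelBlocks` (unimodular
finset-indexed blocks of an integer table: splitting and rank bounds; the tree of pieces and its leaves) ·
`…PeelLocalTable` (the local table (★) of the twelve pieces) · `…PeelTable` (exponent sums of the relators of `P(G)`;
rows and used letters of a peeling state) · `…PeelLocalStep` (the geometry of a gluing at a piece; local certificate
data from local unimodularity) · `…PeelCombine` (certificates of peeling states; the combination step; the set
algebra of one peeling step) · `…PeelRecursion` (the peeling recursion; the unimodular start) ·
`…StubPeelCertificates` (step L0 and the extraction: `theorem stub_peelCertificates : PeelCertificates`).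
-/

open Function
open Literature.Topology.FourManifolds

set_option linter.dupNamespace false

noncomputable section

namespace Summit.SmoothPoincare4.SmoothPoincare4.Theorems.RootDecompAEDoublesShadowLEOneStubPeelCertificates

/-! ## §1 Verbatim twins of the skeleton-local definitions (`Cruxes/DoublesShadowLEOne/Lines/grade_one_ac.lean` §2, §3, §6.2) -/

/-- The pieces of KMN Prop. 4.1: the disc `D`, the pair of pants `P`, the Möbius strip `Y₂`, the circle blocks
`Y₁₁₁, Y₁₂, Y₃` (regular neighbourhoods of a circle component of `SX`), and the eleven figure-eight blocks
`X₁, …, X₁₁` (regular neighbourhoods of an 8-shaped component of `SX` through ONE true vertex), indexed here by the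
11 orbits of sheet-monodromy pairs (our numbering; KMN's Figure numbering is not reproduced). -/
inductive Piece : Type
  | disc
  | pants
  | moebius
  | y111
  | y12
  | y3
  | x8 (i : Fin 11)
  deriving DecidableEq

namespace Piece

/-- Rank of the free fundamental group of the piece's spine (point, circle, or figure-eight). -/
def rank : Piece → ℕ
  | disc => 0
  | pants => 2
  | moebius => 1
  | y111 => 1
  | y12 => 1
  | y3 => 1
  | x8 _ => 2

/-- First spine letter `a` (the core circle of `Y₂, Y₁₁₁, Y₁₂, Y₃`; the first loop of the figure-eight). -/
def la : FreeGroup (Fin 2) := FreeGroup.of 0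
/-- Second spine letter `b` (second loop of the figure-eight / of the pants' spine). -/
def lb : FreeGroup (Fin 2) := FreeGroup.of 1

/-- PORT TABLES of the eleven figure-eight blocks: the boundary circles of the regular neighbourhood of the 8-graph
`a ∪ b`, read as words in `F(a, b)` (`A = a⁻¹`, `B = b⁻¹`; total length 6 per block — each of the 6 sheet germs at
the vertex is traversed once).  Orbit representatives `(σ₁, σ₂)` and words (gen11/enum/xpieces.json):
0 `[a, abAB, b]` · 1 `[a, abbAB]` · 2 `[a, abaB, b]` · 3 `[a, abbaB]` · 4 `[a, aBBAB]` · 5 `[a, aB, ab, b]` ·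
6 `[a, aB, abb]` · 7 `[abbABa]` · 8 `[abbaBa]` · 9 `[abba, aB]` · 10 `[aba, aBB]`.
Checks: type 0 + three discs = KMN Exercise 4.2 (A) (torus with discs on meridian and longitude: regions `a`, `b`,
`[a,b]`); type 5 + two discs on `aB`, `ab` + an annulus joining `a`, `b` = Exercise 4.2 (B) (`ℝP²` with an annulus
on two lines), presentation `⟨a, b, t ∣ ab⁻¹, ab, atb^{±1}t⁻¹⟩ ≅ ℤ × ℤ/2 = π₁(ℝP³ × S¹)` as KMN state. -/
def x8Ports : Fin 11 → List (FreeGroup (Fin 2)) :=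
  ![ [la, la * lb * la⁻¹ * lb⁻¹, lb],
     [la, la * lb * lb * la⁻¹ * lb⁻¹],
     [la, la * lb * la * lb⁻¹, lb],
     [la, la * lb * lb * la * lb⁻¹],
     [la, la * lb⁻¹ * lb⁻¹ * la⁻¹ * lb⁻¹],
     [la, la * lb⁻¹, la * lb, lb],
     [la, la * lb⁻¹, la * lb * lb],
     [la * lb * lb * la⁻¹ * lb⁻¹ * la],
     [la * lb * lb * la * lb⁻¹ * la],
     [la * lb * lb * la, la * lb⁻¹],
     [la * lb * la, la * lb⁻¹ * lb⁻¹] ]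

/-- PORT WORDS of every piece: `D ↦ [1]` (rank 0); `P ↦ [a, b, ab]` (pants = mapping cylinder of three circles
onto a figure-eight spine); `Y₂ ↦ [a²]`; `Y₁₁₁ ↦ [a, a, a]`; `Y₁₂ ↦ [a, a²]`; `Y₃ ↦ [a³]`; `Xᵢ ↦ x8Ports i`. -/
def ports : Piece → List (FreeGroup (Fin 2))
  | disc => [1]
  | pants => [la, lb, la * lb]
  | moebius => [la * la]
  | y111 => [la, la, la]
  | y12 => [la, la * la]
  | y3 => [la * la * la]
  | x8 i => x8Ports i

/-- Number of boundary circles (ports) of a piece. -/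
def numPorts (p : Piece) : ℕ := p.ports.length

/-- The `j`-th port word of a piece (junk value `1` out of range). -/
def portWord (p : Piece) (j : ℕ) : FreeGroup (Fin 2) := p.ports.getD j 1

/-- The piece contains a true vertex (it is one of the eleven figure-eight blocks). -/
def hasVertex : Piece → Bool
  | x8 _ => true
  | _ => false

end Piece

/-- A KMN ENCODING GRAPH (arXiv:1803.06713 §4.2) as finite data: `k` pieces, `m` glued pairs of ports (an edge
`e` glues port `src e = (v, j)` to port `tgt e = (v', j')` with orientation `sgn e`; ports not mentioned stay free
boundary circles), and a choice `tree` of edges (meant to be a spanning tree, see `Admissible`). -/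
structure ShadowGraph where
  /-- number of pieces -/
  k : ℕ
  /-- number of glued port pairs -/
  m : ℕ
  /-- the piece at each vertex of the encoding graph -/
  piece : Fin k → Piece
  /-- first port of the `e`-th gluing: (piece index, port index) -/
  src : Fin m → Fin k × ℕ
  /-- second port of the `e`-th gluing -/
  tgt : Fin m → Fin k × ℕ
  /-- gluing orientation of the `e`-th pair of boundary circles -/
  sgn : Fin m → Bool
  /-- the edges of the chosen spanning tree (their stable letters are killed) -/
  tree : Fin m → Bool

namespace ShadowGraph

variable (G : ShadowGraph)

/-- All `2m` port references used by the gluings. -/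
def endpoints : Fin G.m ⊕ Fin G.m → Fin G.k × ℕ := Sum.elim G.src G.tgt

/-- Every referenced port exists. -/
def PortsValid : Prop :=
  ∀ e : Fin G.m, (G.src e).2 < (G.piece (G.src e).1).numPorts ∧ (G.tgt e).2 < (G.piece (G.tgt e).1).numPorts

/-- No boundary circle is glued twice. -/
def PortsInjective : Prop := Function.Injective G.endpoints

/-- The simple graph on pieces spanned by the tree edges. -/
def treeAdj : SimpleGraph (Fin G.k) :=
  SimpleGraph.fromRel fun u v => ∃ e : Fin G.m, G.tree e = true ∧ (G.src e).1 = u ∧ (G.tgt e).1 = v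

/-- The tree edges form a spanning tree of the encoding graph: no tree edge is a self-gluing, they connect all
pieces, and there are exactly `k − 1` of them (so in particular `X_G` is connected). -/
def IsSpanningTree : Prop :=
  (∀ e, G.tree e = true → (G.src e).1 ≠ (G.tgt e).1) ∧ G.treeAdj.Connected ∧
    (Finset.univ.filter fun e => G.tree e = true).card + 1 = G.k

/-- ADMISSIBLE encoding graphs: valid ports, no port glued twice, a genuine spanning tree.  (Connected complexity
≤ 1 is automatic: every figure-eight block is a whole component of `SX_G` with exactly one vertex, since gluing
along boundary circles creates no new singular points.) -/
def Admissible : Prop := G.PortsValid ∧ G.PortsInjective ∧ G.IsSpanningTree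

/-- SUB-GRADING used by the attack on `GradeOneAC`: the number of figure-eight blocks (= true vertices = `c(X_G)`).
`numVertices G = 0` is the vertex-free row decided in print (Naoe: an acyclic simple polyhedron with `c* = 0`
collapses onto a disc, cited in KMN §4.2). -/
def numVertices : ℕ := (Finset.univ.filter fun v => (G.piece v).hasVertex = true).card

/-- GENERATORS of the uniform encoding: two spine letters per piece and one stable letter per glued pair. -/
abbrev Gen : Type := (Fin G.k × Fin 2) ⊕ Fin G.m

/-- RELATOR INDICES of the uniform encoding: one gluing relator per glued pair, one killing relator per tree edge
(its stable letter), one killing relator per unused spine letter `(v, i)` with `rank(piece v) ≤ i`. -/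
abbrev Rel : Type := Fin G.m ⊕ {e : Fin G.m // G.tree e = true} ⊕ {p : Fin G.k × Fin 2 // (G.piece p.1).rank ≤ (p.2 : ℕ)}

/-- The spine letters of piece `v` inside the big free group. -/
def embed (v : Fin G.k) : FreeGroup (Fin 2) →* FreeGroup G.Gen :=
  FreeGroup.map fun i => Sum.inl (v, i)

/-- The word of port `(v, j)` in the big free group. -/
def portWordAt (p : Fin G.k × ℕ) : FreeGroup G.Gen := G.embed p.1 ((G.piece p.1).portWord p.2)

/-- The stable letter of the `e`-th glued pair. -/
def stable (e : Fin G.m) : FreeGroup G.Gen := FreeGroup.of (Sum.inr e)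

/-- The GLUING RELATOR of the `e`-th pair: `w_src · t_e · w_tgt^{±1} · t_e⁻¹` (van Kampen for the graph of spaces
whose vertex spaces are the pieces' mapping cylinders and whose edge spaces are the glued circles). -/
def gluingRelator (e : Fin G.m) : FreeGroup G.Gen :=
  G.portWordAt (G.src e) * G.stable e * (if G.sgn e then G.portWordAt (G.tgt e) else (G.portWordAt (G.tgt e))⁻¹) *
    (G.stable e)⁻¹

/-- All relators of the uniform encoding. -/
def relator : G.Rel → FreeGroup G.Gen
  | Sum.inl e => G.gluingRelator e
  | Sum.inr (Sum.inl e) => G.stable e.1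
  | Sum.inr (Sum.inr p) => FreeGroup.of (Sum.inl p.1)

/-- THE PRESENTATION `P(G)` of the encoding graph, transported to `Fin n` along bijections of the generator and
relator index types (which exist iff `P(G)` is balanced iff `Σ_v rank = k − 1` iff `χ(X_G) = 1`; different
bijections give presentations differing by a renaming of generators and a permutation of relators). -/
def presentation {n : ℕ} (eg : G.Gen ≃ Fin n) (er : G.Rel ≃ Fin n) : BalancedPresentation n :=
  fun j => FreeGroup.map eg (G.relator (er.symm j))

end ShadowGraph

/-- `GradeOneAC` REDUCED TO THE DICHOTOMY: if every admissible `P(G)` presenting the trivial group admits a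
signed–permuted triangular certificate, then `GradeOneAC` holds.  (This is the formal route of the gen12 NODE: the
remaining formalisation is the peeling induction producing `σ, s, rk`; its paper proof is `NODE-g12.md` §3.) -/
def PeelCertificates : Prop :=
  ∀ (G : ShadowGraph) (n : ℕ) (eg : G.Gen ≃ Fin n) (er : G.Rel ≃ Fin n),
    G.Admissible → (G.presentation eg er).PresentsTrivialGroup →
    ∃ (σ : Equiv.Perm (Fin n)) (s : Fin n → Bool) (rk : Fin n → ℕ),
      ∀ i, IsConj (FreeGroup.lift (fun j => if rk j < rk i then 1 else FreeGroup.of j)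
        (if s i then (G.presentation eg er (σ i))⁻¹ else G.presentation eg er (σ i))) (FreeGroup.of i)

/-- Re-certification of the statement text of the registered stub (critic ruling (x)): `PeelCertificates` unfolds,
by `Iff.rfl`, to the quantified certificate statement over the twinned `ShadowGraph` encoding. -/
example : PeelCertificates ↔
    ∀ (G : ShadowGraph) (n : ℕ) (eg : G.Gen ≃ Fin n) (er : G.Rel ≃ Fin n),
      G.Admissible → (G.presentation eg er).PresentsTrivialGroup →
      ∃ (σ : Equiv.Perm (Fin n)) (s : Fin n → Bool) (rk : Fin n → ℕ),
        ∀ i, IsConj (FreeGroup.lift (fun j => if rk j < rk i then 1 else FreeGroup.of j)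
          (if s i then (G.presentation eg er (σ i))⁻¹ else G.presentation eg er (σ i))) (FreeGroup.of i) :=
  Iff.rfl

/-! ## §2 Free-group bookkeeping: signed words, exponent sums, and `H₁ = 0 ⟹ unimodular exponent matrix` -/

section FreeGroupLemmas

variable {ι : Type} [DecidableEq ι]

/-- A word or its inverse, selected by a Boolean sign. -/
def sgnw {α : Type} (t : Bool) (w : FreeGroup α) : FreeGroup α := if t then w⁻¹ else w

/-- `sgnw` in a free group, as an `if`. -/
theorem sgnw_eq_ite {α : Type} (t : Bool) (w : FreeGroup α) : sgnw t w = if t then w⁻¹ else w := rfl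

/-- Double sign: `sgnw t (sgnw t' w) = sgnw (t xor t') w`. -/
theorem sgnw_sgnw {α : Type} (t t' : Bool) (w : FreeGroup α) : sgnw t (sgnw t' w) = sgnw (xor t t') w := by
  cases t <;> cases t' <;> simp [sgnw]

/-- The exponent-sum character of the generator `j` (multiplicative notation). -/
def gexp (j : ι) : FreeGroup ι →* Multiplicative ℤ :=
  FreeGroup.lift fun i => if i = j then Multiplicative.ofAdd 1 else 1

/-- The exponent sum of the generator `j` in the word `w`. -/
def expo (j : ι) (w : FreeGroup ι) : ℤ := Multiplicative.toAdd (gexp j w)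

/-- Exponent sum of a letter in a one-letter word. -/
@[simp] theorem expo_of (i j : ι) : expo j (FreeGroup.of i) = if i = j then 1 else 0 := by
  unfold expo gexp
  rw [FreeGroup.lift_apply_of]
  split_ifs <;> rfl

/-- Exponent sums are additive. -/
@[simp] theorem expo_mul (j : ι) (v w : FreeGroup ι) : expo j (v * w) = expo j v + expo j w := by
  unfold expo; rw [map_mul, toAdd_mul]

/-- Exponent sums change sign under inversion. -/
@[simp] theorem expo_inv (j : ι) (w : FreeGroup ι) : expo j w⁻¹ = -expo j w := by
  unfold expo; rw [map_inv, toAdd_inv]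

/-- The empty word has all exponent sums zero. -/
@[simp] theorem expo_one (j : ι) : expo j (1 : FreeGroup ι) = 0 := by
  unfold expo; rw [map_one, toAdd_one]

/-- Exponent sums are conjugation invariant. -/
theorem expo_conj (j : ι) (g w : FreeGroup ι) : expo j (g * w * g⁻¹) = expo j w := by
  simp only [expo_mul, expo_inv]; ring

/-- Exponent sums along a renaming of the generators by an equivalence. -/
theorem expo_map_equiv {κ : Type} [DecidableEq κ] (e : ι ≃ κ) (j : κ) (w : FreeGroup ι) :
    expo j (FreeGroup.map e w) = expo (e.symm j) w := by
  have h : (gexp j).comp (FreeGroup.map e) = gexp (e.symm j) := by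
    refine FreeGroup.ext_hom _ _ fun i => ?_
    simp only [MonoidHom.coe_comp, Function.comp_apply, FreeGroup.map.of, gexp, FreeGroup.lift_apply_of]
    by_cases hij : e i = j
    · have : i = e.symm j := by rw [← hij]; simp
      simp [this]
    · have : i ≠ e.symm j := by rintro rfl; simp at hij
      simp [hij, this]
  unfold expo
  exact congrArg Multiplicative.toAdd (DFunLike.congr_fun h w)

/-- THE EXPONENT MATRIX of a family of words `R : ι → FreeGroup ι`: entry `(r, j)` is the exponent sum of the
generator `j` in the word `R r`. -/
def expoMat [Fintype ι] (R : ι → FreeGroup ι) : Matrix ι ι ℤ := Matrix.of fun r j => expo j (R r)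

/-- The words whose exponent vector is an integer combination of the exponent vectors of the `R r` form a
NORMAL subgroup (it is the preimage of a subgroup of the abelianisation). -/
def combSubgroup [Fintype ι] (R : ι → FreeGroup ι) : Subgroup (FreeGroup ι) where
  carrier := {w | ∃ c : ι → ℤ, ∀ j, expo j w = ∑ r, c r * expo j (R r)}
  one_mem' := ⟨0, fun j => by simp⟩
  mul_mem' := by
    rintro v w ⟨c, hc⟩ ⟨d, hd⟩
    refine ⟨c + d, fun j => ?_⟩
    simp only [expo_mul, hc, hd, Pi.add_apply, add_mul, Finset.sum_add_distrib]
  inv_mem' := by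
    rintro w ⟨c, hc⟩
    refine ⟨-c, fun j => ?_⟩
    simp only [expo_inv, hc, Pi.neg_apply, neg_mul, Finset.sum_neg_distrib]

/-- The kernel of all exponent sums that vanish on the relators is a normal subgroup. -/
theorem combSubgroup_normal [Fintype ι] (R : ι → FreeGroup ι) : (combSubgroup R).Normal := by
  refine ⟨fun w hw g => ?_⟩
  obtain ⟨c, hc⟩ := hw
  refine ⟨c, fun j => ?_⟩
  rw [expo_conj]
  exact hc j

/-- **`H₁ = 0 ⟹ unimodular`.**  If the words `R r` normally generate the free group (the presentation
`⟨ι ∣ R⟩` is the trivial group), then the exponent matrix is invertible over `ℤ`: its determinant is a unit. -/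
theorem isUnit_det_expoMat [Fintype ι] (R : ι → FreeGroup ι)
    (h : Subgroup.normalClosure (Set.range R) = ⊤) : IsUnit (expoMat R).det := by
  classical
  haveI := combSubgroup_normal R
  have hle : Subgroup.normalClosure (Set.range R) ≤ combSubgroup R := by
    refine Subgroup.normalClosure_le_normal ?_
    rintro _ ⟨r, rfl⟩
    refine ⟨fun r' => if r' = r then 1 else 0, fun j => ?_⟩
    simp [Finset.sum_ite_eq']
  have hmem : ∀ j : ι, ∃ c : ι → ℤ, ∀ j', expo j' (FreeGroup.of j) = ∑ r, c r * expo j' (R r) := by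
    intro j
    have : FreeGroup.of j ∈ combSubgroup R := hle (by rw [h]; exact Subgroup.mem_top _)
    exact this
  choose c hc using hmem
  let C : Matrix ι ι ℤ := Matrix.of fun j r => c j r
  have hCM : C * expoMat R = 1 := by
    ext j j'
    rw [Matrix.mul_apply, Matrix.one_apply]
    have := hc j j'
    rw [expo_of] at this
    simp only [C, expoMat, Matrix.of_apply]
    rw [← this]
  have hdet : C.det * (expoMat R).det = 1 := by rw [← Matrix.det_mul, hCM, Matrix.det_one]
  have hdet' : (expoMat R).det * C.det = 1 := by rw [mul_comm]; exact hdet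
  exact ⟨⟨(expoMat R).det, C.det, hdet', hdet⟩, rfl⟩

end FreeGroupLemmas

end Summit.SmoothPoincare4.SmoothPoincare4.Theorems.RootDecompAEDoublesShadowLEOneStubPeelCertificates
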